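import Summits.Ventures.CertifiedArithmetic.LowPrec.DoubleRoundingProductSameQuantumCoarse

/-!
# Double rounding of products: the two-grid window (the coarse window with the target abstracted)

HONEST FRAMING (venture CertifiedArithmetic / cell `pub-lowprec`): certified error envelopes and
provably optimal rounding/accumulation schemes for low-precision formats under stated cost models;
every table by two implementations; no hardware or vendor claims.

`DoubleRoundingProductSameQuantumCoarse.lean` proved THE COARSE WINDOW for a normal cell of the
target `φ` at equal quanta.  Here the same argument is run ONCE with the target abstracted away:
a CELL is a segment `[B, B + 2H]` on which `fl_φ` is `B` below the midpoint `μ = B + H`, `B + 2H`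
above it, and one of the two at `μ` (hypotheses `hlow`, `hhigh`, `hmid` — supplied by the gap
lemmas for a normal cell, by `toRat_roundNE_natMul_add_small` for a cell `[c, c+1]·q` of the low
zone, by `toRat_roundNE_eq_zero_of_abs_le_half` for the bottom cell `[0, q]`); the register `ψ`
holds every point of a uniform grid `B + i·S`, `S = 2·2^g·s`, `H = 2^a·S` (`hψpt`; finer values
of `ψ` elsewhere on the cell only shrink the true window); `x = B + r·s`, `r < 2^(a+g+2)`; and a
flag `T` that holds whenever `μ` is a value of `ψ` with an EVEN significand (`hT`).  Conclusion
(§1): a slip `fl_φ (fl_ψ x) ≠ fl_φ x` forces `|r - 2^(a+g+1)| ≤ 2^g` on the side of `μ` that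
`fl_φ` sends away from `fl_φ x`, the boundary (a tie of `ψ`) included only if `T`.  This is the
one lemma behind every zone of the decision of `DRMul` at a FINER register quantum
(`DoubleRoundingProductStripFineZones.lean`, `…StripFineLaw.lean`).
PLACEMENT — KNOWN: slips of double rounding happen only through midpoints of the target
([MartinDorelMelquiondMuller2013, Property 2.1]; [BoldoMelquiond2008, Thm 3]; [Figueroa1995,
§2–3]).  NEW: nothing but the bookkeeping.  No hardware or vendor claims.
-/

namespace Summit.Ventures.CertifiedArithmetic

open Literature.ComputerArithmetic.FloatingPoint
open Literature.ComputerArithmetic.FloatingPoint.Format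
open Literature.ComputerArithmetic.FloatingPoint.MiniFloat

/-! ## §1 A slip forces the two-grid window -/

/-- THE TWO-GRID WINDOW (pointwise, target abstracted): on a cell `[B, B + 2H]` where `fl_φ` is
`B` on `[B, B + H)`, `B + 2H` on `(B + H, B + 2H]` and `B` or `B + 2H` at `μ = B + H`, with the
register holding every `B + i·S` (`i ≤ 2^(a+1)`, `S = 2·2^g·s`, `H = 2^(a+g+1)·s`), a flag `T`
implied by "`μ` is a value of `ψ` with an even significand", and `x = B + r·s`, `r < 2^(a+g+2)`:
a slip `fl_φ (fl_ψ x) ≠ fl_φ x` forces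
`(fl_φ μ = B ∧ 2^(a+g+1) < r ∧ (r < 2^(a+g+1) + 2^g ∨ (T ∧ r = 2^(a+g+1) + 2^g))) ∨
 (fl_φ μ = B + 2H ∧ r < 2^(a+g+1) ∧ (2^(a+g+1) < r + 2^g ∨ (T ∧ r + 2^g = 2^(a+g+1))))`.
[this packet; cite: MartinDorelMelquiondMuller2013, Property 2.1] -/
theorem twoGrid_window_of_roundNE_roundNE_ne {φ ψ : Format} (h1ψ : 1 ≤ ψ.manBits)
    {s B H S : ℚ} (hs0 : 0 < s) {a g r : ℕ} (hH : H = 2 ^ (a + g + 1) * s)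
    (hS : S = 2 * (2 ^ g * s)) (hr : r < 2 ^ (a + g + 2)) {T : Prop}
    (hψpt : ∀ i : ℕ, i ≤ 2 ^ (a + 1) → ∃ z : MiniFloat ψ, z.toRat = B + (i : ℚ) * S)
    (hlow : ∀ y : ℚ, B ≤ y → y < B + H → (roundNE φ y).toRat = B)
    (hhigh : ∀ y : ℚ, B + H < y → y ≤ B + 2 * H → (roundNE φ y).toRat = B + 2 * H)
    (hmid : (roundNE φ (B + H)).toRat = B ∨ (roundNE φ (B + H)).toRat = B + 2 * H)
    (hT : ∀ z : MiniFloat ψ, z.toRat = B + H → 2 ∣ z.man → T)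
    (hne : (roundNE φ (roundNE ψ (B + (r : ℚ) * s)).toRat).toRat
      ≠ (roundNE φ (B + (r : ℚ) * s)).toRat) :
    ((roundNE φ (B + H)).toRat = B ∧ 2 ^ (a + g + 1) < r ∧
        (r < 2 ^ (a + g + 1) + 2 ^ g ∨ (T ∧ r = 2 ^ (a + g + 1) + 2 ^ g))) ∨
      ((roundNE φ (B + H)).toRat = B + 2 * H ∧ r < 2 ^ (a + g + 1) ∧
        (2 ^ (a + g + 1) < r + 2 ^ g ∨ (T ∧ r + 2 ^ g = 2 ^ (a + g + 1)))) := by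
  have hH0 : 0 < H := by rw [hH]; positivity
  set x : ℚ := B + (r : ℚ) * s with hx
  have hrs0 : 0 ≤ (r : ℚ) * s := by positivity
  have hr2 : (r : ℚ) < 2 * 2 ^ (a + g + 1) := by
    have : (r : ℚ) < 2 ^ (a + g + 2) := by exact_mod_cast hr
    rw [pow_succ] at this; linarith
  have hrs2 : (r : ℚ) * s < 2 * H := by
    rw [hH]; have := mul_lt_mul_of_pos_right hr2 hs0; linarith
  have h1a : 1 ≤ 2 ^ a := Nat.one_le_two_pow
  have hpa : 2 ^ (a + 1) = 2 * 2 ^ a := pow_succ' 2 a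
  have hHS : H = (2 : ℚ) ^ a * S := by rw [hH, hS]; ring
  -- the grid points `B`, `μ = B + H`, `B + 2H`, `μ ± S`
  obtain ⟨zV, hzV⟩ := hψpt 0 (Nat.zero_le _)
  obtain ⟨zμ, hzμ⟩ := hψpt (2 ^ a) (by omega)
  obtain ⟨zV', hzV'⟩ := hψpt (2 ^ (a + 1)) le_rfl
  replace hzV : zV.toRat = B := by rw [hzV]; push_cast; ring
  replace hzμ : zμ.toRat = B + H := by rw [hzμ, hHS]; push_cast; ring
  replace hzV' : zV'.toRat = B + 2 * H := by rw [hzV', hHS, hpa]; push_cast; ring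
  -- `fl_ψ x` is within `S/2 = 2^g s` of `x`
  have hdist : |x - (roundNE ψ x).toRat| ≤ 2 ^ g * s := by
    obtain ⟨kk, hk⟩ : ∃ kk, r / 2 ^ (g + 1) = kk := ⟨_, rfl⟩
    obtain ⟨ρ, hρ'⟩ : ∃ ρ, r % 2 ^ (g + 1) = ρ := ⟨_, rfl⟩
    have hρ : r = kk * 2 ^ (g + 1) + ρ := by
      rw [← hk, ← hρ']; exact (Nat.div_add_mod' r (2 ^ (g + 1))).symm
    have hρlt : ρ < 2 ^ (g + 1) := by rw [← hρ']; exact Nat.mod_lt _ (by positivity)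
    have hk1 : kk < 2 ^ (a + 1) := by
      rw [← hk, Nat.div_lt_iff_lt_mul (by positivity), ← pow_add,
        show a + 1 + (g + 1) = a + g + 2 by omega]
      exact hr
    have hg2 : (2 : ℚ) ^ (g + 1) = 2 * 2 ^ g := pow_succ' 2 g
    have hρq : (r : ℚ) = (kk : ℚ) * 2 ^ (g + 1) + ρ := by exact_mod_cast hρ
    rcases le_or_gt (ρ * 2) (2 ^ (g + 1)) with hlo | hhi
    · obtain ⟨z, hz⟩ := hψpt kk hk1.le
      refine le_trans (roundNE_nearest (φ := ψ) x z) ?_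
      have e : x - z.toRat = (ρ : ℚ) * s := by
        rw [hx, hz, hρq, hS, hg2]; ring
      have : (ρ : ℚ) * 2 ≤ 2 ^ (g + 1) := by exact_mod_cast hlo
      rw [e, abs_of_nonneg (by positivity)]; rw [hg2] at this
      exact mul_le_mul_of_nonneg_right (by linarith) hs0.le
    · obtain ⟨z, hz⟩ := hψpt (kk + 1) hk1
      refine le_trans (roundNE_nearest (φ := ψ) x z) ?_
      have e : x - z.toRat = -(((2 ^ (g + 1) - ρ : ℕ) : ℚ) * s) := by
        rw [hx, hz, hρq, hS, Nat.cast_sub hρlt.le]; push_cast; rw [hg2]; ring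
      have : (((2 ^ (g + 1) - ρ : ℕ)) : ℚ) * 2 ≤ 2 ^ (g + 1) := by
        exact_mod_cast (by omega : (2 ^ (g + 1) - ρ) * 2 ≤ 2 ^ (g + 1))
      rw [e, abs_neg, abs_of_nonneg (by positivity)]; rw [hg2] at this
      exact mul_le_mul_of_nonneg_right (by linarith) hs0.le
  have h2B : B ≠ B + 2 * H := by linarith
  -- case analysis on the position of `x` in its cell
  rcases lt_trichotomy r (2 ^ (a + g + 1)) with hrn | hrn | hrn
  · -- below the midpoint: `fl_φ x = B`, `fl_ψ x ∈ [B, μ]`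
    right
    have hrns : (r : ℚ) * s < H := by
      rw [hH]; exact mul_lt_mul_of_pos_right (by exact_mod_cast hrn) hs0
    have hx1 : B ≤ x := by rw [hx]; linarith
    have hx2 : x < B + H := by rw [hx]; linarith
    have hfx : (roundNE φ x).toRat = B := hlow x hx1 hx2
    have hy1 : B ≤ (roundNE ψ x).toRat := by
      have := toRat_roundNE_mono (φ := ψ) hx1
      rwa [← hzV, toRat_roundNE_toRat, hzV] at this
    have hy2 : (roundNE ψ x).toRat ≤ B + H := by
      have := toRat_roundNE_mono (φ := ψ) hx2.le
      rwa [← hzμ, toRat_roundNE_toRat, hzμ] at this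
    rcases lt_or_eq_of_le hy2 with hlt | heq
    · exact absurd ((hlow _ hy1 hlt).trans hfx.symm) hne
    · -- `fl_ψ x = μ`: distance, the value of `fl_φ` at `μ`, and the refined boundary
      have hd2 : ((2 : ℚ) ^ (a + g + 1) - r) * s ≤ 2 ^ g * s := by
        have := hdist
        rwa [heq, hx, hH, show B + (r : ℚ) * s - (B + 2 ^ (a + g + 1) * s)
          = -((2 ^ (a + g + 1) - r) * s) by ring, abs_neg,
          abs_of_nonneg (mul_nonneg (sub_nonneg.2 (by exact_mod_cast hrn.le)) hs0.le)] at this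
      have hd3 : (2 : ℚ) ^ (a + g + 1) - r ≤ 2 ^ g := le_of_mul_le_mul_right hd2 hs0
      have hd2' : 2 ^ (a + g + 1) ≤ r + 2 ^ g := by
        have h' : ((2 ^ (a + g + 1) : ℕ) : ℚ) ≤ ((r + 2 ^ g : ℕ) : ℚ) := by push_cast; linarith
        exact_mod_cast h'
      have hmid' : (roundNE φ (B + H)).toRat = B + 2 * H := by
        rcases hmid with h | h
        · rw [← heq] at h; exact absurd (h.trans hfx.symm) hne
        · exact h
      refine ⟨hmid', hrn, ?_⟩
      rcases lt_or_eq_of_le hd2' with hlt' | heq'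
      · exact Or.inl hlt'
      · refine Or.inr ⟨?_, heq'.symm⟩
        -- `x` is a tie of `ψ` between `μ - S` and `μ`: ties-to-even
        obtain ⟨zlo, hzlo⟩ := hψpt (2 ^ a - 1) (by omega)
        have hr' : (r : ℚ) = 2 ^ (a + g + 1) - 2 ^ g := by
          have e1 : ((2 ^ (a + g + 1) : ℕ) : ℚ) = ((r + 2 ^ g : ℕ) : ℚ) := by rw [heq']
          push_cast at e1; linarith
        have hzlo' : zlo.toRat = B + H - S := by
          rw [hzlo, Nat.cast_sub h1a, hHS]; push_cast; ring
        have hxlo : x - zlo.toRat = 2 ^ g * s := by rw [hzlo', hx, hr', hH, hS]; ring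
        have hxμ : x - (roundNE ψ x).toRat = -(2 ^ g * s) := by rw [heq, hx, hr', hH]; ring
        have htie : |x - zlo.toRat| = |x - (roundNE ψ x).toRat| := by rw [hxlo, hxμ, abs_neg]
        have hne2 : zlo.toRat ≠ (roundNE ψ x).toRat := by
          rw [hzlo', heq, hS]
          have : (0 : ℚ) < 2 ^ g * s := by positivity
          linarith
        exact hT _ heq (roundNE_man_even_of_tie h1ψ htie hne2)
  · -- `x` is the midpoint itself, a value of `ψ`: no slip
    exact absurd (toRat_roundNE_roundNE_of_exists ⟨zμ, by rw [hzμ, hx, hrn, hH]; push_cast; ring⟩)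
      hne
  · -- above the midpoint: `fl_φ x = B + 2H`, `fl_ψ x ∈ [μ, B + 2H]`
    left
    have hrns : H < (r : ℚ) * s := by
      rw [hH]; exact mul_lt_mul_of_pos_right (by exact_mod_cast hrn) hs0
    have hx1 : B + H < x := by rw [hx]; linarith
    have hx2 : x ≤ B + 2 * H := by rw [hx]; linarith
    have hfx : (roundNE φ x).toRat = B + 2 * H := hhigh x hx1 hx2
    have hy1 : B + H ≤ (roundNE ψ x).toRat := by
      have := toRat_roundNE_mono (φ := ψ) hx1.le
      rwa [← hzμ, toRat_roundNE_toRat, hzμ] at this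
    have hy2 : (roundNE ψ x).toRat ≤ B + 2 * H := by
      have := toRat_roundNE_mono (φ := ψ) hx2
      rwa [← hzV', toRat_roundNE_toRat, hzV'] at this
    rcases lt_or_eq_of_le hy1 with hlt | heq
    · exact absurd ((hhigh _ hlt hy2).trans hfx.symm) hne
    · have hd2 : ((r : ℚ) - 2 ^ (a + g + 1)) * s ≤ 2 ^ g * s := by
        have := hdist
        rwa [← heq, hx, hH, show B + (r : ℚ) * s - (B + 2 ^ (a + g + 1) * s)
          = (r - 2 ^ (a + g + 1)) * s by ring,
          abs_of_nonneg (mul_nonneg (sub_nonneg.2 (by exact_mod_cast hrn.le)) hs0.le)] at this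
      have hd3 : (r : ℚ) - 2 ^ (a + g + 1) ≤ 2 ^ g := le_of_mul_le_mul_right hd2 hs0
      have hd2' : r ≤ 2 ^ (a + g + 1) + 2 ^ g := by
        have h' : (r : ℚ) ≤ ((2 ^ (a + g + 1) + 2 ^ g : ℕ) : ℚ) := by push_cast; linarith
        exact_mod_cast h'
      have hmid' : (roundNE φ (B + H)).toRat = B := by
        rcases hmid with h | h
        · exact h
        · rw [heq] at h; exact absurd (h.trans hfx.symm) hne
      refine ⟨hmid', hrn, ?_⟩
      rcases lt_or_eq_of_le hd2' with hlt' | heq'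
      · exact Or.inl hlt'
      · refine Or.inr ⟨?_, heq'⟩
        -- `x` is a tie of `ψ` between `μ` and `μ + S`: ties-to-even
        obtain ⟨zhi, hzhi⟩ := hψpt (2 ^ a + 1) (by omega)
        have hr' : (r : ℚ) = 2 ^ (a + g + 1) + 2 ^ g := by exact_mod_cast heq'
        have hzhi' : zhi.toRat = B + H + S := by
          rw [hzhi, hHS]; push_cast; ring
        have hxhi : x - zhi.toRat = -(2 ^ g * s) := by rw [hzhi', hx, hr', hH, hS]; ring
        have hxμ : x - (roundNE ψ x).toRat = 2 ^ g * s := by rw [← heq, hx, hr', hH]; ring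
        have htie : |x - zhi.toRat| = |x - (roundNE ψ x).toRat| := by rw [hxhi, hxμ, abs_neg]
        have hne2 : zhi.toRat ≠ (roundNE ψ x).toRat := by
          rw [hzhi', ← heq, hS]
          have : (0 : ℚ) < 2 ^ g * s := by positivity
          linarith
        exact hT _ heq.symm (roundNE_man_even_of_tie h1ψ htie hne2)

end Summit.Ventures.CertifiedArithmetic
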